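import Summits.ABC.IUTFork.Thm311RealInd1StripPacketNormalisationTransferGeneral
import HarnessLib

/-!
# [IUTchIII] Thm 3.11 (i) (Ind1)+(Ind2), genuine packet of ANY number of factors: the ROOM INEQUALITY of the monomial floor (R25) is SHARP at `e_{i₀} ∣ v`
# for every factor count — bits only on `S` + failing room ⟹ the junction identity FAILS (UNCONDITIONAL) — and the `e_{i₀} ∣ v + 1` converse with
# failing bits at the slot and one more factor; the residual strip of the failing-room region at `|I| ≥ 3` is FLAGGED, not claimed

PROOF-ONLY file (abc-iut cell, Cor. 3.12 sub-crew, seat abc-iut-c312-1 = holder of record of the typed [IUTchIII] Thm. 3.11, gen 19; row «R26 =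
C:ROOM-SHARPNESS», KEY ROOMSHARP, C LEAD ruling C-R171 (a); file (θ′), sequel of (θ) `Thm311RealInd1StripPacketNormalisationTransferGeneral`).  TAKES NO
SIDE on [IUTchIII] Cor. 3.12.  No definition, no `Prop` fact, NO `JannsenWingbergMappingClass` (all UNCONDITIONAL; failing bits = displayed `hfix` binders).
SETTING of (θ)/R25: packet `⊗_{i∈I} K_{w_i}` (tame), slot `i₀`, `‖g‖ = p^{−v/E}`, `A = (v−1) div E + 1 − |I|`, container radius `R = ‖p^{A}‖·∏_i p^{−1/e_i}`
(attained, R25 (B) `exists_mem_zpow_smul_logPacket_not_mem_polydisc`), star radius `R′_⋆ = ‖g‖·∏_{i≠⋆} p^{1−1/e_i}` of (θ) §2/§3.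
* §1 **`starRadius_lt_container_of_dvd`** — `E ∣ v`, `e_⋆ ≥ 2` ⟹ `R′_⋆ < R` (ratio `p^{−(1−1/e_⋆)}`); **`starRadius_lt_container_of_dvd_succ`** — `E ∣ v + 1`,
  `1/E + 1/e_⋆ < 1` ⟹ `R′_⋆ < R` (ratio `p^{−(1−1/E−1/e_⋆)}`).  Pure arithmetic of the exponents.
* §2 **`packetHull_orbit_ne_container_of_dvd_of_not_room`** — THE CONVERSE AT `e_{i₀} ∣ v`, ANY `|I| ≥ 2`: bits available only on `S` (off `S`: residue
  degree one, failing bit `hfix`), and R25 (A) §2's room inequality `((v−1) % E + 1)/E + Σ_{i ∈ univ ∖ S} 1/e_i ≤ 1` FAILING (VERBATIM, negated) ⟹ for every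
  factorwise-strip `H` the `(R_I)^∼`-hull of the `H`-orbit of `ι_{i₀}(g)·(R_I)^∼` is NOT `packetHull(p^{A}·log_p(R_I^×))` (the failing inequality produces a factor
  `⋆ ∉ S`; (θ) §2 confines the hull to `R′_⋆ < R`; R25 (B′) §5 `packetHull_ne_of_subset_polydisc_of_lt`).  With R25 (A) §2 (room holding ⟹ identity, mod hMC,
  for `H ≤ indTwo` containing the strip moves): at `e_{i₀} ∣ v` the room inequality is the EXACT threshold, at every factor count.
* §3 **`packetHull_orbit_ne_container_of_dvd_succ`** — `E ∣ v + 1` (`r = E − 2`) with failing bits at the slot AND at some `⋆ ≠ i₀`, `1/E + 1/e_⋆ < 1` ⟹ the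
  hull is NOT the container's ((θ) §3 + §1).  This hypothesis IMPLIES the failure of the room inequality (`Σ_{i∉S} 1/e_i ≥ 1/E + 1/e_⋆ > 1/E`) but is
  STRONGER than it.
FLAG (the residual strip, desk-verified, NOT typed): at `|I| ≥ 3` the failing-room region `{r ≤ E − 3} ∪ {r = E − 2, bit available at the slot}` is reached
by NEITHER §2 nor §3 — there the intersection of all star boxes `∩_⋆ ⊗_{i≠⋆} d_i⁻¹·R_I` still meets the container radius although `(R_I)^∼` does not
(e.g. `e = (5,5,5)`, `v = 3`, `S = ∅`: room `6/5 > 1`); closing it needs «`(R_I)^∼` = the monomial box of power bases at tame residue-degree-one packets»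
(abc-iut-E-t58's `MonomialBox` WITHOUT the incongruence hypothesis; with it the desk threshold is the room inequality exactly).  Hence «sharp at every
factor count» is typed at `e_{i₀} ∣ v` (and at `|I| = 2` throughout, R25), and OPEN AS TYPED on that strip.
READING (numbers about OUR typed objects; neutral); which value a bit takes is NOT claimed; HONEST SCOPE as (θ): unconditional; OUR typings; EVEN degree,
WILD, `p = 2` outside; equal-AS-TYPED ≠ equal in print; nothing here asserts that abc is proved or refuted; no side taken on [IUTchIII] Cor. 3.12 / [IUTchIV]
Thm. 1.10, on (U) vs (P), or on any author. [claim: Mochizuki2012, status: disputed];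
[cite: Mochizuki2012, IUTchIII Thm. 3.11 (i) p. 154; Rmk. 3.9.5 (i) p. 127; Cor. 3.12 Step (xi) p. 183; IUTchIV Prop. 1.1 p. 9, Prop. 1.2 (ii) pp. 10–11, Prop. 1.4 (i) p. 13];
[cite: DupuyHilado2025, §4.9, §4.12]; [cite: SerreLocalFields1979, Ch. III §6 Prop. 13]. typed ≠ proved.
-/

set_option autoImplicit false

noncomputable section

open Metric Set Bornology Function
open scoped Pointwise TensorProduct NormedField

namespace Summit.ABC.IUTFork.Thm311.Real

open NumberField IsDedekindDomain Literature.NumberTheory.NumberFields Literature.IUT.LogVolume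
open Literature.NumberTheory.GaloisRepresentations Literature.NumberTheory.GaloisRepresentations.Ultrametric
open Literature.AnabelianGeometry.AbsoluteAnabelian Literature.IUT.HodgeArakelov
open Literature.IUT.HodgeArakelov.AbsTopMonoids

variable {K : Type} [Field K] [NumberField K] (p : ℕ) [hp : Fact p.Prime]
variable {I : Type} [Fintype I] [DecidableEq I] (w : I → HeightOneSpectrum (𝓞 K)) (hw : ∀ i, ((p : ℕ) : 𝓞 K) ∈ (w i).asIdeal)

/-! ## §1 The star radius is below the container radius -/

/-- `∏_{i≠⋆} p^{1−1/e_i} = p^{|I|−1} · ∏_{i≠⋆} p^{−1/e_i}`. [folklore] -/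
private theorem prod_erase_rpow_one_sub (star : I) :
    ∏ i ∈ Finset.univ.erase star, (p : ℝ) ^ (1 - 1 / (absRamificationIdx p (RescaledCompletion K p (w i) (hw i)) : ℝ)) =
      (p : ℝ) ^ ((Fintype.card I : ℝ) - 1) *
        ∏ i ∈ Finset.univ.erase star, (p : ℝ) ^ (-(1 / (absRamificationIdx p (RescaledCompletion K p (w i) (hw i)) : ℝ))) := by
  have hP : p.Prime := Fact.out
  have hp0 : (0 : ℝ) < p := by exact_mod_cast hP.pos
  rw [Finset.prod_congr rfl (fun i _ => show (p : ℝ) ^ (1 - 1 / (absRamificationIdx p (RescaledCompletion K p (w i) (hw i)) : ℝ)) =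
      (p : ℝ) * (p : ℝ) ^ (-(1 / (absRamificationIdx p (RescaledCompletion K p (w i) (hw i)) : ℝ))) by
      rw [sub_eq_add_neg, Real.rpow_add hp0, Real.rpow_one]),
    Finset.prod_mul_distrib, Finset.prod_const, Finset.card_erase_of_mem (Finset.mem_univ _), Finset.card_univ,
    ← Real.rpow_natCast]
  congr 2
  have h1 : 1 ≤ Fintype.card I := Fintype.card_pos_iff.mpr ⟨star⟩
  rw [Nat.cast_sub h1, Nat.cast_one]

/-- **`E ∣ v`, `e_⋆ ≥ 2` ⟹ `R′_⋆ < R`:** `‖g‖·∏_{i≠⋆} p^{1−1/e_i} < ‖p^{A}‖·∏_i p^{−1/e_i}` with `A = (v−1) div E + 1 − |I|` (`v = E·m` ⇒ `A = m − |I|`; the ratio is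
`p^{−(1−1/e_⋆)}`: the defect at a factor with a failing bit is `(1 − 1/e_⋆)·log p`, as for the box — R24 p554348). [cite: Mochizuki2012, IUTchIV Prop. 1.2 (ii) p. 10] -/
theorem starRadius_lt_container_of_dvd (i₀ : I) {g : RescaledCompletion K p (w i₀) (hw i₀)} {v : ℤ}
    (hv : ‖g‖ = (p : ℝ) ^ (-(v / (absRamificationIdx p (RescaledCompletion K p (w i₀) (hw i₀)) : ℝ))))
    (hdvd : ((absRamificationIdx p (RescaledCompletion K p (w i₀) (hw i₀)) : ℤ)) ∣ v) (star : I)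
    (hes : 2 ≤ absRamificationIdx p (RescaledCompletion K p (w star) (hw star))) :
    ‖g‖ * ∏ i ∈ Finset.univ.erase star, (p : ℝ) ^ (1 - 1 / (absRamificationIdx p (RescaledCompletion K p (w i) (hw i)) : ℝ)) <
      ‖(p : ℚ_[p]) ^ ((v - 1) / (absRamificationIdx p (RescaledCompletion K p (w i₀) (hw i₀)) : ℤ) + 1 - Fintype.card I)‖ *
        ∏ i, (p : ℝ) ^ (-(1 / (absRamificationIdx p (RescaledCompletion K p (w i) (hw i)) : ℝ))) := by
  set E : ℕ := absRamificationIdx p (RescaledCompletion K p (w i₀) (hw i₀)) with hE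
  set Es : ℕ := absRamificationIdx p (RescaledCompletion K p (w star) (hw star)) with hEs
  have hP : p.Prime := Fact.out
  have hp0 : (0 : ℝ) < p := by exact_mod_cast hP.pos
  have hp1 : (1 : ℝ) < p := by exact_mod_cast hP.one_lt
  have hEpos : 0 < E := absRamificationIdx_pos p _
  have hE0 : (0 : ℝ) < (E : ℝ) := by exact_mod_cast hEpos
  have hEs0 : (0 : ℝ) < (Es : ℝ) := by exact_mod_cast absRamificationIdx_pos p (RescaledCompletion K p (w star) (hw star))
  obtain ⟨m, hm⟩ := hdvd
  have hA : (v - 1) / (E : ℤ) + 1 - Fintype.card I = m - Fintype.card I := by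
    rw [hm, show (E : ℤ) * m - 1 = (E - 1) + (E : ℤ) * (m - 1) by ring, Int.add_mul_ediv_left _ _ (by exact_mod_cast hEpos.ne'),
      Int.ediv_eq_zero_of_lt (by omega) (by omega)]
    ring
  have hgn : ‖g‖ = (p : ℝ) ^ (-(m : ℝ)) := by
    rw [hv, show (v : ℝ) / (absRamificationIdx p (RescaledCompletion K p (w i₀) (hw i₀)) : ℝ) = (v : ℝ) / (E : ℝ) from rfl, hm]
    push_cast; congr 2; exact mul_div_cancel_left₀ _ hE0.ne'
  set Q : ℝ := (∏ i ∈ Finset.univ.erase star, (p : ℝ) ^ (-(1 / (absRamificationIdx p (RescaledCompletion K p (w i) (hw i)) : ℝ)))) with hQ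
  have hQ0 : 0 < Q := Finset.prod_pos fun i _ => Real.rpow_pos_of_pos hp0 _
  rw [prod_erase_rpow_one_sub p w hw star, hA, hgn, norm_zpow, Padic.norm_p, inv_zpow', ← Real.rpow_intCast,
    ← Finset.mul_prod_erase Finset.univ _ (Finset.mem_univ star), ← mul_assoc, ← mul_assoc, ← Real.rpow_add hp0, ← Real.rpow_add hp0]
  refine mul_lt_mul_of_pos_right (Real.rpow_lt_rpow_of_exponent_lt hp1 ?_) hQ0
  have h2 : (1 : ℝ) / (Es : ℝ) ≤ 1 / 2 := one_div_le_one_div_of_le (by norm_num) (by exact_mod_cast hes)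
  rw [show (absRamificationIdx p (RescaledCompletion K p (w star) (hw star)) : ℝ) = (Es : ℝ) from rfl]
  push_cast; linarith

/-- **`E ∣ v + 1`, `1/E + 1/e_⋆ < 1` ⟹ `R′_⋆ < R`** (`v = E·m − 1` ⇒ `A = m − |I|` for `E ≥ 2`; ratio `p^{−(1−1/E−1/e_⋆)}`). [cite: Mochizuki2012, IUTchIV Prop. 1.2 (ii) p. 10] -/
theorem starRadius_lt_container_of_dvd_succ (i₀ : I) {g : RescaledCompletion K p (w i₀) (hw i₀)} {v : ℤ}
    (hv : ‖g‖ = (p : ℝ) ^ (-(v / (absRamificationIdx p (RescaledCompletion K p (w i₀) (hw i₀)) : ℝ))))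
    (hdvd : ((absRamificationIdx p (RescaledCompletion K p (w i₀) (hw i₀)) : ℤ)) ∣ v + 1) (star : I)
    (hlt : (1 : ℝ) / (absRamificationIdx p (RescaledCompletion K p (w i₀) (hw i₀)) : ℝ) +
      1 / (absRamificationIdx p (RescaledCompletion K p (w star) (hw star)) : ℝ) < 1) :
    ‖g‖ * ∏ i ∈ Finset.univ.erase star, (p : ℝ) ^ (1 - 1 / (absRamificationIdx p (RescaledCompletion K p (w i) (hw i)) : ℝ)) <
      ‖(p : ℚ_[p]) ^ ((v - 1) / (absRamificationIdx p (RescaledCompletion K p (w i₀) (hw i₀)) : ℤ) + 1 - Fintype.card I)‖ *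
        ∏ i, (p : ℝ) ^ (-(1 / (absRamificationIdx p (RescaledCompletion K p (w i) (hw i)) : ℝ))) := by
  set E : ℕ := absRamificationIdx p (RescaledCompletion K p (w i₀) (hw i₀)) with hE
  set Es : ℕ := absRamificationIdx p (RescaledCompletion K p (w star) (hw star)) with hEs
  have hP : p.Prime := Fact.out
  have hp0 : (0 : ℝ) < p := by exact_mod_cast hP.pos
  have hp1 : (1 : ℝ) < p := by exact_mod_cast hP.one_lt
  have hEpos : 0 < E := absRamificationIdx_pos p _
  have hE0 : (0 : ℝ) < (E : ℝ) := by exact_mod_cast hEpos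
  have hEs0 : (0 : ℝ) < (Es : ℝ) := by exact_mod_cast absRamificationIdx_pos p (RescaledCompletion K p (w star) (hw star))
  have hE2 : 2 ≤ E := by
    by_contra hlt'
    have h1 : E = 1 := by omega
    have : (1 : ℝ) ≤ 1 / (E : ℝ) := by rw [h1]; norm_num
    have : (0 : ℝ) < 1 / (Es : ℝ) := by positivity
    rw [show (absRamificationIdx p (RescaledCompletion K p (w star) (hw star)) : ℝ) = (Es : ℝ) from rfl] at hlt
    linarith
  obtain ⟨m, hm⟩ := hdvd
  have hA : (v - 1) / (E : ℤ) + 1 - Fintype.card I = m - Fintype.card I := by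
    rw [show v - 1 = (E - 2) + (E : ℤ) * (m - 1) by linear_combination hm, Int.add_mul_ediv_left _ _ (by exact_mod_cast hEpos.ne'),
      Int.ediv_eq_zero_of_lt (by omega) (by omega)]
    ring
  have hgn : ‖g‖ = (p : ℝ) ^ (-(m : ℝ) + 1 / (E : ℝ)) := by
    rw [hv, show (v : ℝ) / (absRamificationIdx p (RescaledCompletion K p (w i₀) (hw i₀)) : ℝ) = (v : ℝ) / (E : ℝ) from rfl,
      show (v : ℝ) = (E : ℝ) * m - 1 by exact_mod_cast (show v = (E : ℤ) * m - 1 by linear_combination hm)]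
    congr 1
    rw [sub_div, mul_div_cancel_left₀ (m : ℝ) hE0.ne']
    ring
  set Q : ℝ := (∏ i ∈ Finset.univ.erase star, (p : ℝ) ^ (-(1 / (absRamificationIdx p (RescaledCompletion K p (w i) (hw i)) : ℝ)))) with hQ
  have hQ0 : 0 < Q := Finset.prod_pos fun i _ => Real.rpow_pos_of_pos hp0 _
  rw [prod_erase_rpow_one_sub p w hw star, hA, hgn, norm_zpow, Padic.norm_p, inv_zpow', ← Real.rpow_intCast,
    ← Finset.mul_prod_erase Finset.univ _ (Finset.mem_univ star), ← mul_assoc, ← mul_assoc, ← Real.rpow_add hp0, ← Real.rpow_add hp0]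
  refine mul_lt_mul_of_pos_right (Real.rpow_lt_rpow_of_exponent_lt hp1 ?_) hQ0
  rw [show (absRamificationIdx p (RescaledCompletion K p (w star) (hw star)) : ℝ) = (Es : ℝ) from rfl] at hlt ⊢
  push_cast; linarith

/-! ## §2 THE CONVERSE at `e_{i₀} ∣ v`: bits only on `S` + failing room ⟹ the junction identity fails (any number of factors) -/

/-- **THE ROOM INEQUALITY IS SHARP AT `e_{i₀} ∣ v`, FOR EVERY FACTOR COUNT (UNCONDITIONAL).**  Packet `⊗_{i∈I} K_{w_i}` (`|I| ≥ 2`, every factor tame with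
`e_i ≥ 2` and local degree `≥ 2`), `‖g‖ = p^{−v/E}` with `E ∣ v`; bits available only on `S ⊆ I`: OFF `S` every factor has residue degree one and NO realised
strip automorphism moves `ℤ_p·p` modulo `p·log_p(𝒪^×)` (`hfix`); and R25 (A) §2's room inequality FAILS:
`¬ ( ((v−1) % E + 1)/E + Σ_{i ∈ univ ∖ S} 1/e_i ≤ 1 )` — at `E ∣ v` this says exactly `S ≠ univ`.  Then for EVERY `H ≤ Aut_{ℚ_p}(X)` acting factorwise through the
realised strip groups, the `(R_I)^∼`-hull of the `H`-orbit of the Θ-region `ι_{i₀}(g)·(R_I)^∼` is NOT `packetHull(p^{A}·log_p(R_I^×))`: a factor `⋆ ∉ S` exists,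
(θ) §2 confines the hull to the polydisc `R′_⋆`, `R′_⋆ < R` (§1), and the container span attains `R` (R25 (B′) §5).  Converse of R25 (A) §2 (room ⟹ identity,
mod hMC) at `r = E − 1`. [claim: Mochizuki2012, status: disputed] [cite: Mochizuki2012, IUTchIII Thm. 3.11 (i) p. 154; Rmk. 3.9.5 (i) p. 127; IUTchIV Prop. 1.1 p. 9]
[cite: DupuyHilado2025, §4.9, §4.12] -/
theorem packetHull_orbit_ne_container_of_dvd_of_not_room (hI : 2 ≤ Fintype.card I) (hp2 : 2 < p)
    (he : ∀ i, absRamificationIdx p (RescaledCompletion K p (w i) (hw i)) ≤ p - 2)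
    (he2 : ∀ i, 2 ≤ absRamificationIdx p (RescaledCompletion K p (w i) (hw i))) (hd2 : ∀ i, 2 ≤ localDeg K (w i))
    (i₀ : I) {g : RescaledCompletion K p (w i₀) (hw i₀)} {v : ℤ}
    (hv : ‖g‖ = (p : ℝ) ^ (-(v / (absRamificationIdx p (RescaledCompletion K p (w i₀) (hw i₀)) : ℝ))))
    (hdvd : ((absRamificationIdx p (RescaledCompletion K p (w i₀) (hw i₀)) : ℤ)) ∣ v)
    (S : Finset I) (hfS : ∀ i, i ∉ S → (w i).asIdeal.inertiaDeg ℤ = 1)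
    (hfixS : ∀ i, i ∉ S → ∀ ψ ∈ ind1StripOf (w i) (galoisLog (w i)),
      RescaledCompletion.of K p (w i) (hw i) (ψ (p : (w i).adicCompletion K)) - (p : RescaledCompletion K p (w i) (hw i)) ∈
        (p : ℚ_[p]) • logUnits (RescaledCompletion K p (w i) (hw i)))
    (hnotroom : ¬ ((((v - 1) % (absRamificationIdx p (RescaledCompletion K p (w i₀) (hw i₀)) : ℤ) + 1 : ℤ) : ℝ) /
        (absRamificationIdx p (RescaledCompletion K p (w i₀) (hw i₀)) : ℝ) +
      ∑ i ∈ Finset.univ \ S, (1 : ℝ) / (absRamificationIdx p (RescaledCompletion K p (w i) (hw i)) : ℝ) ≤ 1))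
    (H : Subgroup (PacketAlgebra p (fun i => RescaledCompletion K p (w i) (hw i)) ≃ₗ[ℚ_[p]]
      PacketAlgebra p (fun i => RescaledCompletion K p (w i) (hw i))))
    (hHfac : ∀ γ ∈ H, ∃ δ : Π i, AddAut ((w i).adicCompletion K),
      (∀ i, δ i ∈ AddSubgroup.closure (G := AddAut ((w i).adicCompletion K)) (ind1StripOf (w i) (galoisLog (w i)))) ∧
      ∀ z : Π i, RescaledCompletion K p (w i) (hw i),
        γ (PiTensorProduct.tprod ℚ_[p] z) =
          PiTensorProduct.tprod ℚ_[p] (fun i => RescaledCompletion.of K p (w i) (hw i)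
            (δ i ((RescaledCompletion.of K p (w i) (hw i)).symm (z i))))) :
    packetHull p (fun i => RescaledCompletion K p (w i) (hw i))
        (⋃ γ : H, (γ : PacketAlgebra p (fun i => RescaledCompletion K p (w i) (hw i)) ≃ₗ[ℚ_[p]]
            PacketAlgebra p (fun i => RescaledCompletion K p (w i) (hw i))) ''
          (iota p (fun i => RescaledCompletion K p (w i) (hw i)) i₀ g •
            (normalizedPacket p (fun i => RescaledCompletion K p (w i) (hw i)) :
              Set (PacketAlgebra p (fun i => RescaledCompletion K p (w i) (hw i)))))) ≠
      packetHull p (fun i => RescaledCompletion K p (w i) (hw i))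
        (((p : ℚ_[p]) ^ ((v - 1) / (absRamificationIdx p (RescaledCompletion K p (w i₀) (hw i₀)) : ℤ) + 1 - Fintype.card I)) •
          (logPacket p (fun i => RescaledCompletion K p (w i) (hw i)) :
            Set (PacketAlgebra p (fun i => RescaledCompletion K p (w i) (hw i))))) := by
  classical
  haveI : Nonempty I := ⟨i₀⟩
  set E : ℕ := absRamificationIdx p (RescaledCompletion K p (w i₀) (hw i₀)) with hE
  have hEpos : 0 < E := absRamificationIdx_pos p _
  have hE0 : (0 : ℝ) < (E : ℝ) := by exact_mod_cast hEpos
  -- at `E ∣ v` the first term of the room is `1`, so its failure produces a factor off `S`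
  obtain ⟨m, hm⟩ := hdvd
  have hr : (v - 1) % (E : ℤ) + 1 = E := by
    rw [hm, show (E : ℤ) * m - 1 = (E - 1) + (E : ℤ) * (m - 1) by ring, Int.add_mul_emod_self_left,
      Int.emod_eq_of_lt (by omega) (by omega)]
    ring
  have hstar : ∃ star, star ∉ S := by
    by_contra hall
    push Not at hall
    apply hnotroom
    rw [hr, show Finset.univ \ S = ∅ from Finset.sdiff_eq_empty_iff_subset.mpr fun i _ => hall i, Finset.sum_empty, add_zero]
    push_cast
    rw [div_self hE0.ne']
  obtain ⟨star, hstarS⟩ := hstar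
  refine packetHull_ne_of_subset_polydisc_of_lt p w hw hp2 he hd2 _
    (starRadius_lt_container_of_dvd p w hw i₀ hv ⟨m, hm⟩ star (he2 star)) ?_
  exact packetHull_orbit_smul_normalizedPacket_subset_polydisc_of_dvd_of_fixesBaseLine_star p w hw hI hp2 he i₀ hv ⟨m, hm⟩ star
    (hfS star hstarS) (hfixS star hstarS) H hHfac

/-! ## §3 `e_{i₀} ∣ v + 1`: failing bits at the slot and at one more factor ⟹ the junction identity fails (any number of factors) -/

/-- **`E ∣ v + 1` (`r = E − 2`): failing bits at the slot `i₀` AND at a factor `⋆ ≠ i₀` with `1/E + 1/e_⋆ < 1` ⟹ the hull of every factorwise-strip orbit of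
`ι_{i₀}(g)·(R_I)^∼` is NOT `packetHull(p^{A}·log_p(R_I^×))` (UNCONDITIONAL, any `|I| ≥ 2`; (θ) §3 + §1 + R25 (B′) §5).  This hypothesis implies — and at `|I| ≥ 3`
is STRONGER than — the failure of R25 (A) §2's room inequality for every `S` avoiding `i₀` and `⋆` (`Σ_{i∉S} 1/e_i ≥ 1/E + 1/e_⋆ > 1/E`); the rest of the
failing-room region at `r = E − 2` (bit available at the slot) is the FLAGGED strip of the header.  `|I| = 2`: R25 (B′) §4 with §5 (c).
[claim: Mochizuki2012, status: disputed] [cite: Mochizuki2012, IUTchIII Thm. 3.11 (i) p. 154; Rmk. 3.9.5 (i) p. 127; IUTchIV Prop. 1.1 p. 9] [cite: DupuyHilado2025, §4.9, §4.12] -/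
theorem packetHull_orbit_ne_container_of_dvd_succ (hI : 2 ≤ Fintype.card I) (hp2 : 2 < p)
    (he : ∀ i, absRamificationIdx p (RescaledCompletion K p (w i) (hw i)) ≤ p - 2) (hd2 : ∀ i, 2 ≤ localDeg K (w i))
    (i₀ : I) {g : RescaledCompletion K p (w i₀) (hw i₀)} {v : ℤ}
    (hv : ‖g‖ = (p : ℝ) ^ (-(v / (absRamificationIdx p (RescaledCompletion K p (w i₀) (hw i₀)) : ℝ))))
    (hdvd : ((absRamificationIdx p (RescaledCompletion K p (w i₀) (hw i₀)) : ℤ)) ∣ v + 1)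
    (star : I) (hstar : star ≠ i₀)
    (hlt : (1 : ℝ) / (absRamificationIdx p (RescaledCompletion K p (w i₀) (hw i₀)) : ℝ) +
      1 / (absRamificationIdx p (RescaledCompletion K p (w star) (hw star)) : ℝ) < 1)
    (hf₀ : (w i₀).asIdeal.inertiaDeg ℤ = 1) (hfs : (w star).asIdeal.inertiaDeg ℤ = 1)
    (hfix₀ : ∀ ψ ∈ ind1StripOf (w i₀) (galoisLog (w i₀)),
      RescaledCompletion.of K p (w i₀) (hw i₀) (ψ (p : (w i₀).adicCompletion K)) - (p : RescaledCompletion K p (w i₀) (hw i₀)) ∈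
        (p : ℚ_[p]) • logUnits (RescaledCompletion K p (w i₀) (hw i₀)))
    (hfixs : ∀ ψ ∈ ind1StripOf (w star) (galoisLog (w star)),
      RescaledCompletion.of K p (w star) (hw star) (ψ (p : (w star).adicCompletion K)) - (p : RescaledCompletion K p (w star) (hw star)) ∈
        (p : ℚ_[p]) • logUnits (RescaledCompletion K p (w star) (hw star)))
    (H : Subgroup (PacketAlgebra p (fun i => RescaledCompletion K p (w i) (hw i)) ≃ₗ[ℚ_[p]]
      PacketAlgebra p (fun i => RescaledCompletion K p (w i) (hw i))))
    (hHfac : ∀ γ ∈ H, ∃ δ : Π i, AddAut ((w i).adicCompletion K),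
      (∀ i, δ i ∈ AddSubgroup.closure (G := AddAut ((w i).adicCompletion K)) (ind1StripOf (w i) (galoisLog (w i)))) ∧
      ∀ z : Π i, RescaledCompletion K p (w i) (hw i),
        γ (PiTensorProduct.tprod ℚ_[p] z) =
          PiTensorProduct.tprod ℚ_[p] (fun i => RescaledCompletion.of K p (w i) (hw i)
            (δ i ((RescaledCompletion.of K p (w i) (hw i)).symm (z i))))) :
    packetHull p (fun i => RescaledCompletion K p (w i) (hw i))
        (⋃ γ : H, (γ : PacketAlgebra p (fun i => RescaledCompletion K p (w i) (hw i)) ≃ₗ[ℚ_[p]]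
            PacketAlgebra p (fun i => RescaledCompletion K p (w i) (hw i))) ''
          (iota p (fun i => RescaledCompletion K p (w i) (hw i)) i₀ g •
            (normalizedPacket p (fun i => RescaledCompletion K p (w i) (hw i)) :
              Set (PacketAlgebra p (fun i => RescaledCompletion K p (w i) (hw i)))))) ≠
      packetHull p (fun i => RescaledCompletion K p (w i) (hw i))
        (((p : ℚ_[p]) ^ ((v - 1) / (absRamificationIdx p (RescaledCompletion K p (w i₀) (hw i₀)) : ℤ) + 1 - Fintype.card I)) •
          (logPacket p (fun i => RescaledCompletion K p (w i) (hw i)) :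
            Set (PacketAlgebra p (fun i => RescaledCompletion K p (w i) (hw i))))) := by
  haveI : Nonempty I := ⟨i₀⟩
  refine packetHull_ne_of_subset_polydisc_of_lt p w hw hp2 he hd2 _
    (starRadius_lt_container_of_dvd_succ p w hw i₀ hv hdvd star hlt) ?_
  exact packetHull_orbit_smul_normalizedPacket_subset_polydisc_of_dvd_succ_of_fixesBaseLine_star p w hw hI hp2 he i₀ hv hdvd star hstar
    hf₀ hfs hfix₀ hfixs H hHfac

end Summit.ABC.IUTFork.Thm311.Real
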